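import Mathlib
import Summits.NavierStokesRegularity.NavierStokesRegularity.Theorems.ThreadingFluxHorizonTowerNullConeInjective
import Summits.NavierStokesRegularity.NavierStokesRegularity.Theorems.ThreadingFluxHorizonTowerNullConeBinaryForms
import HarnessLib

/-!
# Crux `PoloidalLiouville` (stmt-NavierStokesRegularity-1222), crux idea «horizon-threading-tower» (ns-idea-15):
# ZONAL AXES FROM THE NULL-CONE CHART — a solid harmonic whose chart is a `D`-th power is zonal

Support file (`--supports stmt-NavierStokesRegularity-1222`, helper; cell `ns-wall-extremal`, width hand ns-wall-eng-3 g4; 0 kit).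

The rotation derivative of a polynomial `H` about the axis `a` is (minus) the loop bracket with the linear form `⟪a,x⟫`:
`⟪a × x, ∇H⟫ = −det(∇⟪a,x⟫, ∇H, x) = −detP ⟪a,x⟫ H`.  This file proves:

* `lapP_detP_lin` — rotation derivatives commute with the flat Laplacian (so `detP ⟪a,x⟫ H` is a solid harmonic with `H`);
* `chartT_detP_lin_eq_zero_of_chartT_eq` — if `chartT H = β · (chartT ⟪a,x⟫)^D` then the rotation derivative has ZERO chart
  (weighted Wronskian law `Zonal.chartT_detP`), hence ★ `detP_lin_eq_zero_of_chartT_eq` — it VANISHES (injectivity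
  `Zonal.eq_zero_of_chartT_eq_zero`): `H` is zonal about the (complex) axis `a`;
* `exists_chartT_eq_C_mul_pow_of_detP_lin_eq_zero` — conversely a form of degree `D ≥ 1` zonal about `a ≠ 0` has chart\n  `β·(chartT ⟪a,x⟫)^D`;
* ★ `exists_real_axis_of_detP_lin_eq_zero` — for a REAL solid harmonic a complex zonal axis yields a REAL one (real/imaginary split);
* `inner_cross_gradient_eq_neg_evalE` — dictionary with the analytic side: `⟪n × y, ∇H(y)⟫ = −(detP ⟪n,x⟫ H)(y)`.

HONEST LABEL: polynomial algebra about one crux idea's typed objects; no sketch Prop closed; `HorizonTowerZonality` (general towers),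
`PoloidalLiouville` (1222) OPEN; NS regularity NOT proved.  [folklore]
-/

-- the summit and its single sub-problem share the name (CONVENTIONS §1)
set_option linter.dupNamespace false

noncomputable section

open MvPolynomial Complex
open scoped Polynomial RealInnerProductSpace
open Literature.Analysis.FluidPDE (cross)
open Literature.Geometry.DiscreteGeometry (inner_fin3)

namespace Summit.NavierStokesRegularity.NavierStokesRegularity.Theorems.PoloidalLiouville.HorizonTower.Zonal

/-! ### The rotation derivative `detP ⟪a,x⟫ ·` : explicit form, linearity in the axis -/

section General

variable {R : Type*} [CommRing R]

/-- Explicit form of the bracket with a linear form: `detP ⟪a,x⟫ p = x₀(a₁∂₂p − a₂∂₁p) + x₁(a₂∂₀p − a₀∂₂p) + x₂(a₀∂₁p − a₁∂₀p)`. [folklore] -/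
theorem detP_lin (a : Fin 3 → R) (p : MvPolynomial (Fin 3) R) :
    detP (C (a 0) * X 0 + C (a 1) * X 1 + C (a 2) * X 2) p
      = X 0 * (C (a 1) * pderiv 2 p - C (a 2) * pderiv 1 p) + X 1 * (C (a 2) * pderiv 0 p - C (a 0) * pderiv 2 p)
        + X 2 * (C (a 0) * pderiv 1 p - C (a 1) * pderiv 0 p) := by
  simp only [detP, map_add, pderiv_C_mul, pderiv_X_self,
    pderiv_X_of_ne (show (1 : Fin 3) ≠ 0 by decide), pderiv_X_of_ne (show (2 : Fin 3) ≠ 0 by decide),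
    pderiv_X_of_ne (show (0 : Fin 3) ≠ 1 by decide), pderiv_X_of_ne (show (2 : Fin 3) ≠ 1 by decide),
    pderiv_X_of_ne (show (0 : Fin 3) ≠ 2 by decide), pderiv_X_of_ne (show (1 : Fin 3) ≠ 2 by decide)]
  ring

/-- The bracket with a linear form is linear in the axis: `detP ⟪a,x⟫ p = Σᵢ aᵢ · detP xᵢ p`. [folklore] -/
theorem detP_lin_eq_sum (a : Fin 3 → R) (p : MvPolynomial (Fin 3) R) :
    detP (C (a 0) * X 0 + C (a 1) * X 1 + C (a 2) * X 2) p
      = C (a 0) * detP (X 0) p + C (a 1) * detP (X 1) p + C (a 2) * detP (X 2) p := by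
  rw [detP_lin]
  simp only [detP, pderiv_X_self,
    pderiv_X_of_ne (show (1 : Fin 3) ≠ 0 by decide), pderiv_X_of_ne (show (2 : Fin 3) ≠ 0 by decide),
    pderiv_X_of_ne (show (0 : Fin 3) ≠ 1 by decide), pderiv_X_of_ne (show (2 : Fin 3) ≠ 1 by decide),
    pderiv_X_of_ne (show (0 : Fin 3) ≠ 2 by decide), pderiv_X_of_ne (show (1 : Fin 3) ≠ 2 by decide)]
  ring

/-- Partial derivatives commute (any coefficient ring). [folklore] -/
theorem pderiv_pderiv_comm (i j : Fin 3) (P : MvPolynomial (Fin 3) R) : pderiv i (pderiv j P) = pderiv j (pderiv i P) := by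
  classical
  ext m
  simp only [coeff_pderiv]
  by_cases hij : i = j
  · subst hij; rfl
  · have h1 : (m + Finsupp.single i 1 : Fin 3 →₀ ℕ) j = m j := by
      rw [Finsupp.add_apply, Finsupp.single_apply, if_neg hij, add_zero]
    have h2 : (m + Finsupp.single j 1 : Fin 3 →₀ ℕ) i = m i := by
      rw [Finsupp.add_apply, Finsupp.single_apply, if_neg (Ne.symm hij), add_zero]
    rw [h1, h2, add_right_comm]
    ring

/-- `Δ` commutes with partial derivatives. [folklore] -/
theorem lapP_pderiv (k : Fin 3) (p : MvPolynomial (Fin 3) R) : lapP (pderiv k p) = pderiv k (lapP p) := by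
  simp only [lapP, map_add, pderiv_pderiv_comm k]

/-- `Δ` is additive. [folklore] -/
theorem lapP_add (p q : MvPolynomial (Fin 3) R) : lapP (p + q) = lapP p + lapP q := by
  simp only [lapP, map_add]; ring

/-- `Δ` of a difference. [folklore] -/
theorem lapP_sub (p q : MvPolynomial (Fin 3) R) : lapP (p - q) = lapP p - lapP q := by
  simp only [lapP, map_sub]; ring

/-- `Δ` commutes with constants. [folklore] -/
theorem lapP_C_mul (c : R) (p : MvPolynomial (Fin 3) R) : lapP (C c * p) = C c * lapP p := by
  simp only [lapP, pderiv_C_mul]; ring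

/-- Second derivative of `xᵢ · q` in the direction `i`: `∂ᵢ²(xᵢ q) = xᵢ ∂ᵢ²q + 2 ∂ᵢ q`. [folklore] -/
theorem pderiv_pderiv_X_mul_self (i : Fin 3) (q : MvPolynomial (Fin 3) R) :
    pderiv i (pderiv i (X i * q)) = X i * pderiv i (pderiv i q) + C (2 : R) * pderiv i q := by
  rw [(pderiv i).leibniz, smul_eq_mul, smul_eq_mul, pderiv_X_self, mul_one, map_add, (pderiv i).leibniz, smul_eq_mul,
    smul_eq_mul, pderiv_X_self, mul_one, map_ofNat]
  ring

/-- Second derivative of `xᵢ · q` in a direction `j ≠ i`: `∂ⱼ²(xᵢ q) = xᵢ ∂ⱼ²q`. [folklore] -/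
theorem pderiv_pderiv_X_mul_of_ne {i j : Fin 3} (h : j ≠ i) (q : MvPolynomial (Fin 3) R) :
    pderiv j (pderiv j (X i * q)) = X i * pderiv j (pderiv j q) := by
  rw [(pderiv j).leibniz, smul_eq_mul, smul_eq_mul, pderiv_X_of_ne (Ne.symm h), mul_zero, add_zero, (pderiv j).leibniz,
    smul_eq_mul, smul_eq_mul, pderiv_X_of_ne (Ne.symm h), mul_zero, add_zero]

/-- Flat Laplacian of `xᵢ · q`: `Δ(xᵢ q) = xᵢ Δq + 2 ∂ᵢ q`. [folklore] -/
theorem lapP_X_mul (i : Fin 3) (q : MvPolynomial (Fin 3) R) : lapP (X i * q) = X i * lapP q + C (2 : R) * pderiv i q := by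
  fin_cases i
  · simp only [lapP, Fin.zero_eta, pderiv_pderiv_X_mul_self, pderiv_pderiv_X_mul_of_ne (show (1 : Fin 3) ≠ 0 by decide),
      pderiv_pderiv_X_mul_of_ne (show (2 : Fin 3) ≠ 0 by decide)]
    ring
  · simp only [lapP, Fin.mk_one, pderiv_pderiv_X_mul_self, pderiv_pderiv_X_mul_of_ne (show (0 : Fin 3) ≠ 1 by decide),
      pderiv_pderiv_X_mul_of_ne (show (2 : Fin 3) ≠ 1 by decide)]
    ring
  · simp only [lapP, Fin.reduceFinMk, pderiv_pderiv_X_mul_self, pderiv_pderiv_X_mul_of_ne (show (0 : Fin 3) ≠ 2 by decide),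
      pderiv_pderiv_X_mul_of_ne (show (1 : Fin 3) ≠ 2 by decide)]
    ring

/-- ★ **Rotation derivatives commute with the flat Laplacian**: `Δ (detP ⟪a,x⟫ p) = detP ⟪a,x⟫ (Δ p)`. [folklore] -/
theorem lapP_detP_lin (a : Fin 3 → R) (p : MvPolynomial (Fin 3) R) :
    lapP (detP (C (a 0) * X 0 + C (a 1) * X 1 + C (a 2) * X 2) p)
      = detP (C (a 0) * X 0 + C (a 1) * X 1 + C (a 2) * X 2) (lapP p) := by
  rw [detP_lin, detP_lin, lapP_add, lapP_add, lapP_X_mul, lapP_X_mul, lapP_X_mul, lapP_sub, lapP_sub, lapP_sub,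
    lapP_C_mul, lapP_C_mul, lapP_C_mul, lapP_C_mul, lapP_C_mul, lapP_C_mul, lapP_pderiv, lapP_pderiv, lapP_pderiv,
    map_sub, map_sub, map_sub, pderiv_C_mul, pderiv_C_mul, pderiv_C_mul, pderiv_C_mul, pderiv_C_mul, pderiv_C_mul,
    pderiv_pderiv_comm 0 2, pderiv_pderiv_comm 1 2, pderiv_pderiv_comm 0 1]
  ring

/-- The bracket with a linear form preserves the degree (`D ≥ 1`). [folklore] -/
theorem isHomogeneous_detP_lin (a : Fin 3 → R) {p : MvPolynomial (Fin 3) R} {D : ℕ} (hp : p.IsHomogeneous D) (hD : 1 ≤ D) :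
    (detP (C (a 0) * X 0 + C (a 1) * X 1 + C (a 2) * X 2) p).IsHomogeneous D := by
  obtain ⟨D', rfl⟩ := Nat.exists_eq_add_of_le' hD
  have hd : ∀ i : Fin 3, (pderiv i p).IsHomogeneous D' := fun i => by simpa using hp.pderiv (i := i)
  have hc : ∀ (i j : Fin 3) (c : R), (C c * pderiv j p).IsHomogeneous (0 + D') := fun i j c =>
    (isHomogeneous_C _ _).mul (hd j)
  simp only [zero_add] at hc
  rw [detP_lin]
  have h0 := (isHomogeneous_X R (0 : Fin 3)).mul ((hc 0 2 (a 1)).sub (hc 0 1 (a 2)))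
  have h1 := (isHomogeneous_X R (1 : Fin 3)).mul ((hc 1 0 (a 2)).sub (hc 1 2 (a 0)))
  have h2 := (isHomogeneous_X R (2 : Fin 3)).mul ((hc 2 1 (a 0)).sub (hc 2 0 (a 1)))
  rw [add_comm 1 D'] at h0 h1 h2
  exact (h0.add h1).add h2

end General

/-! ### Zonality from the chart -/

/-- If the chart of `H ∈ 𝓟_D` is `β · q^D` with `q` the chart of the linear form `⟪a,x⟫`, then the rotation derivative of `H` about
`a` has zero chart. [folklore] -/
theorem chartT_detP_lin_eq_zero_of_chartT_eq {H : MvPolynomial (Fin 3) ℂ} {D : ℕ} (hH : H.IsHomogeneous D) (hD : 1 ≤ D)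
    (a : Fin 3 → ℂ) {β : ℂ}
    (hchart : chartT H = Polynomial.C β * chartT (C (a 0) * X 0 + C (a 1) * X 1 + C (a 2) * X 2) ^ D) :
    chartT (detP (C (a 0) * X 0 + C (a 1) * X 1 + C (a 2) * X 2) H) = 0 := by
  have hW := chartT_detP (isHomogeneous_lin a) hH
  rw [hchart, Nat.cast_one, one_mul] at hW
  obtain ⟨D', rfl⟩ : ∃ D', D = D' + 1 := ⟨D - 1, by omega⟩
  rw [Polynomial.derivative_C_mul, Polynomial.derivative_pow_succ,
    show (Polynomial.C ((D' : ℂ) + 1) : ℂ[X]) = (D' : ℂ[X]) + 1 by rw [Polynomial.C_add, Polynomial.C_1, map_natCast]] at hW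
  have h0 : Polynomial.C (2 * I) * chartT (detP (C (a 0) * X 0 + C (a 1) * X 1 + C (a 2) * X 2) H) = 0 := by
    rw [hW]; push_cast; ring
  exact (mul_eq_zero.mp h0).resolve_left (by simp [I_ne_zero])

/-- ★ **ZONALITY FROM THE CHART**: a complex solid harmonic `H ∈ 𝓗_D` whose chart is `β · (chartT ⟪a,x⟫)^D` is annihilated by the
rotation derivative about `a`: `detP ⟪a,x⟫ H = 0`. [folklore] -/
theorem detP_lin_eq_zero_of_chartT_eq {H : MvPolynomial (Fin 3) ℂ} {D : ℕ} (hH : H.IsHomogeneous D) (hD : 1 ≤ D)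
    (hlap : lapP H = 0) (a : Fin 3 → ℂ) {β : ℂ}
    (hchart : chartT H = Polynomial.C β * chartT (C (a 0) * X 0 + C (a 1) * X 1 + C (a 2) * X 2) ^ D) :
    detP (C (a 0) * X 0 + C (a 1) * X 1 + C (a 2) * X 2) H = 0 :=
  eq_zero_of_chartT_eq_zero (isHomogeneous_detP_lin a hH hD) (by rw [lapP_detP_lin, hlap, detP_lin]; simp)
    (chartT_detP_lin_eq_zero_of_chartT_eq hH hD a hchart)

/-- **Converse**: a solid harmonic `H ∈ 𝓟_D` annihilated by the rotation derivative about `a ≠ 0` has chart `β · (chartT ⟪a,x⟫)^D`.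
[folklore] -/
theorem exists_chartT_eq_C_mul_pow_of_detP_lin_eq_zero {H : MvPolynomial (Fin 3) ℂ} {D : ℕ} (hH : H.IsHomogeneous D)
    (hD : 1 ≤ D) {a : Fin 3 → ℂ} (ha : a ≠ 0) (hrot : detP (C (a 0) * X 0 + C (a 1) * X 1 + C (a 2) * X 2) H = 0) :
    ∃ β : ℂ, chartT H = Polynomial.C β * chartT (C (a 0) * X 0 + C (a 1) * X 1 + C (a 2) * X 2) ^ D := by
  set q : ℂ[X] := chartT (C (a 0) * X 0 + C (a 1) * X 1 + C (a 2) * X 2) with hq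
  have hq0 : q ≠ 0 := fun h => ha (lin_eq_zero_of_chartT_eq_zero h)
  have hW := chartT_detP (isHomogeneous_lin a) hH
  rw [hrot, chartT_zero, mul_zero, Nat.cast_one, one_mul] at hW
  -- `q · g′ = D · g · q′` ⇒ `W(q^D, g) = 0`
  obtain ⟨D', rfl⟩ : ∃ D', D = D' + 1 := ⟨D - 1, by omega⟩
  have hWr : Polynomial.wronskian (q ^ (D' + 1)) (chartT H) = 0 := by
    rw [Polynomial.wronskian, Polynomial.derivative_pow_succ,
      show (Polynomial.C ((D' : ℂ) + 1) : ℂ[X]) = (D' : ℂ[X]) + 1 by rw [Polynomial.C_add, Polynomial.C_1, map_natCast]]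
    push_cast at hW
    linear_combination (q ^ D') * hW.symm
  rw [← Polynomial.wronskian_neg_eq, neg_eq_zero] at hWr
  exact exists_C_mul_of_wronskian_eq_zero (pow_ne_zero _ hq0) hWr

/-! ### Real axes -/

/-- A complex polynomial combination `P + i Q` of two REAL polynomials vanishes only if both do. [folklore] -/
theorem map_eq_zero_of_map_add_I_mul_map_eq_zero {P Q : MvPolynomial (Fin 3) ℝ}
    (h : map (algebraMap ℝ ℂ) P + C I * map (algebraMap ℝ ℂ) Q = 0) : P = 0 ∧ Q = 0 := by
  have hcoeff : ∀ d, coeff d P = 0 ∧ coeff d Q = 0 := by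
    intro d
    have := congrArg (coeff d) h
    rw [coeff_add, coeff_C_mul, coeff_map, coeff_map, coeff_zero] at this
    have hre := congrArg Complex.re this
    have him := congrArg Complex.im this
    simp at hre him
    exact ⟨hre, him⟩
  exact ⟨(MvPolynomial.ext _ _ fun d => by rw [(hcoeff d).1, coeff_zero]),
    (MvPolynomial.ext _ _ fun d => by rw [(hcoeff d).2, coeff_zero])⟩

/-- ★ **REAL AXIS**: if a REAL polynomial `H` is annihilated by the rotation derivative about a non-zero COMPLEX axis `a`, it is
annihilated by the rotation derivative about a non-zero REAL axis (`Re a` or `Im a`). [folklore] -/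
theorem exists_real_axis_of_detP_lin_eq_zero {H : MvPolynomial (Fin 3) ℝ} {a : Fin 3 → ℂ} (ha : a ≠ 0)
    (hrot : detP (C (a 0) * X 0 + C (a 1) * X 1 + C (a 2) * X 2) (map (algebraMap ℝ ℂ) H) = 0) :
    ∃ n : Fin 3 → ℝ, n ≠ 0 ∧ detP (C (n 0) * X 0 + C (n 1) * X 1 + C (n 2) * X 2) H = 0 := by
  set nR : Fin 3 → ℝ := fun i => (a i).re with hnR
  set nI : Fin 3 → ℝ := fun i => (a i).im with hnI
  -- split the complex rotation derivative into real and imaginary parts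
  have hai : ∀ i : Fin 3, a i = (algebraMap ℝ ℂ) (nR i) + I * (algebraMap ℝ ℂ) (nI i) := by
    intro i
    apply Complex.ext <;> simp [hnR, hnI]
  have hsplit : detP (C (a 0) * X 0 + C (a 1) * X 1 + C (a 2) * X 2) (map (algebraMap ℝ ℂ) H)
      = map (algebraMap ℝ ℂ) (detP (C (nR 0) * X 0 + C (nR 1) * X 1 + C (nR 2) * X 2) H)
        + C I * map (algebraMap ℝ ℂ) (detP (C (nI 0) * X 0 + C (nI 1) * X 1 + C (nI 2) * X 2) H) := by
    rw [detP_lin, detP_lin, detP_lin, hai 0, hai 1, hai 2]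
    simp only [map_add, map_sub, map_mul, map_X, map_C, ← pderiv_map]
    ring
  rw [hsplit] at hrot
  obtain ⟨hR, hI⟩ := map_eq_zero_of_map_add_I_mul_map_eq_zero hrot
  by_cases hR0 : nR = 0
  · refine ⟨nI, fun hI0 => ha ?_, hI⟩
    funext i
    rw [hai i, hR0, hI0]
    simp
  · exact ⟨nR, hR0, hR⟩

/-! ### Dictionary with the analytic side -/

/-- The gradient of the linear polynomial function `⟪n, ·⟫`. [folklore] -/
theorem gradient_evalE_lin (n : Fin 3 → ℝ) (y : E3) :
    gradient (evalE (C (n 0) * X 0 + C (n 1) * X 1 + C (n 2) * X 2)) y = WithLp.toLp 2 n := by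
  ext j
  rw [gradient_evalE_apply]
  fin_cases j <;>
    simp [evalE, pderiv_X_of_ne (show (1 : Fin 3) ≠ 0 by decide), pderiv_X_of_ne (show (2 : Fin 3) ≠ 0 by decide),
      pderiv_X_of_ne (show (0 : Fin 3) ≠ 1 by decide), pderiv_X_of_ne (show (2 : Fin 3) ≠ 1 by decide),
      pderiv_X_of_ne (show (0 : Fin 3) ≠ 2 by decide), pderiv_X_of_ne (show (1 : Fin 3) ≠ 2 by decide)]

/-- **Dictionary**: the rotation derivative of a polynomial function about the axis `n` is minus the bracket with `⟪n,x⟫`: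
`⟪n × y, ∇p(y)⟫ = −(detP ⟪n,x⟫ p)(y)`. [folklore] -/
theorem inner_cross_gradient_eq_neg_evalE (n : Fin 3 → ℝ) (p : MvPolynomial (Fin 3) ℝ) (y : E3) :
    ⟪cross (WithLp.toLp 2 n) y, gradient (evalE p) y⟫
      = -evalE (detP (C (n 0) * X 0 + C (n 1) * X 1 + C (n 2) * X 2) p) y := by
  rw [inner_fin3]
  obtain ⟨c0, c1, c2⟩ := cross_fin3 (WithLp.toLp 2 n : E3) y
  rw [c0, c1, c2]
  simp only [gradient_evalE_apply, detP_lin]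
  simp [evalE]
  ring

/-- A real polynomial function is annihilated by the rotation derivative about `n` iff `detP ⟪n,x⟫ p = 0`. [folklore] -/
theorem detP_lin_eq_zero_iff (n : Fin 3 → ℝ) (p : MvPolynomial (Fin 3) ℝ) :
    detP (C (n 0) * X 0 + C (n 1) * X 1 + C (n 2) * X 2) p = 0
      ↔ ∀ y : E3, ⟪cross (WithLp.toLp 2 n) y, gradient (evalE p) y⟫ = 0 := by
  constructor
  · intro h y
    rw [inner_cross_gradient_eq_neg_evalE, h]
    simp [evalE]
  · intro h
    apply eq_zero_of_evalE_eq_zero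
    intro y
    have := h y
    rw [inner_cross_gradient_eq_neg_evalE, neg_eq_zero] at this
    exact this

end Summit.NavierStokesRegularity.NavierStokesRegularity.Theorems.PoloidalLiouville.HorizonTower.Zonal

end
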